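import Summits.BirchSwinnertonDyer.BirchSwinnertonDyer.Theorems.InertBadSignedBranchesPrintReadingsInert
import Summits.BirchSwinnertonDyer.Rank1Residual.Additive.SignedTwistOddBranchReadings
import Literature.NumberTheory.EllipticCurves.Kobayashi2003.SignedSelmerEtaComponentFacts
import Literature.NumberTheory.EllipticCurves.KitajimaOtsuki2018.EtaSelmerNoFiniteSubmodule
import Literature.NumberTheory.EllipticCurves.ComplexMultiplicationHasCMProofs
import Mathlib.NumberTheory.Cyclotomic.Basic
import HarnessLib

/-!
# Route `InertBadSignedBranches` (rung K8), item `PrintReadingsInert` (stmt-BirchSwinnertonDyer-19226):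
# the print READINGS instantiated from NAMED LITERATURE FACTS — (R1), (R2) become theorems modulo
# published facts for every `(W, p)`, and the item is reduced to (C1_η)-for-CM alone
# (helper `--supports 19226`; cell bsd-cm, seat bsd-cm-k8i-ty, D-0074 group (G))

HONEST FRAMING (cell bsd-cm, `run/shared/lean/pub/bsd-cm/`): BSD is NOT proved by any of this; the
programme assembles the rank-`≤ 1` formula from PUBLISHED theorems and TYPES the remainder; a closed
item closes a rung leaf, never the summit. THIS FILE books nothing and moves no label. It does three
things, all sorry-free, with TWO definitions (the `rfl` transports, both ways) and NO new fact:

1. **Bridge.** The Literature home of Kobayashi's `K_n`-tower object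
   (`Literature/…/Kobayashi2003/CyclotomicTowerSignedSelmer.lean`, p417950, this seat) is the
   promotion COPY of cc-typer-6's `Additive/CyclotomicTowerSigned{Local,Selmer}.lean` with
   identical bodies (`Kobayashi2003.towerSignedSelmerInftyEta = Additive.towerSignedSelmerInftyEta`
   is `rfl`), so a Summits-side datum `D : Additive.EtaSignedSelmerDualData …` IS a Literature
   datum `D.toLiterature` with the SAME module and characteristic ideal (`rfl`). Likewise the two
   pinning predicates (`Iff.rfl`).
2. **Texts from facts.** The four VERBATIM hypothesis texts of the kernel dictionary theorems —
   `h22`/`h41` (x1b P5-5b `SignedTwist.oddBranchStrictMinusDivisibilityAt_of_kobayashi41OddEta`),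
   `hKO` (`…NoFiniteSubmoduleAt_of_kitajimaOtsuki13MinusEta`), and the `K_∞`-form of Kobayashi
   Thm. 7.4 at `η` — are INSTANCES of the named Literature facts
   `Kobayashi2003.thm22_etaSignedSelmerDual_finite_torsion`, `Kobayashi2003.thm41_minusEtaCharIdeal_dvd`,
   `KitajimaOtsuki2018.mainThm13_etaSignedSelmerDual_noFiniteSubmodule`,
   `Kobayashi2003.thm74_etaEvenMC_iff_etaOddMC` (§2). CONSEQUENCE (§3): the registered typed inputs
   (R1) `Additive.OddBranchStrictMinusDivisibilityAt W p` and (R2)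
   `Additive.OddBranchStrictMinusNoFiniteSubmoduleAt W p` hold FOR EVERY `(W, p)` modulo those named
   PUBLISHED facts (fact-conditional theorems, the tree's standard currency) — in particular the
   gate's auto-crux reason for 19226 («references the registered conjecture
   `OddBranchStrictMinusNoFiniteSubmoduleAt`») is now a reference to a fact-conditional theorem.
3. **The item's exact residual** (§4): `PrintReadingsInert` ⟸ the two named facts (KO18 Thm. 1.3,
   Kob03 Thm. 7.4 at `η`) ∧ (C1_η)-for-CM in its two verbatim forms — `hC1` = conjunct 1 of the item
   itself (the `ℚ(√p*)`-subtower form `Additive.QuadraticBranchPlusMainConjectureAt V p`) and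
   `hC1K` = Kobayashi's EVEN main conjecture at `η` ON `X⁺(V/K_∞)^η` for CM `V` (§4 p. 8 verbatim;
   the plus-side prime-to-`p` descent relating the two forms is not in the tree, flag
   `Kob03-MC-eta-quadratic-subtower`, hence both appear). For CM `V` both are Pollack–Rubin's
   printed REMARK (Ann. of Math. 159 (2004) p. 448, "With the same proof (and a little extra
   notation) one can prove an analogous result for `Sel^±_p(E/ℚ(μ_{p^∞}))`") — NOT a printed
   theorem anywhere (Lei, Compositio 147 (2011) §7: the CM case "with `θ = 1`" only; Kato,
   Astérisque 295 §15 p. 251: divisibility only; the cell's N12 = paper derivation, REMARK-LEVEL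
   ADAPTATION), hence not a Literature fact and not dischargeable: conjunct 1 of the item is
   conjecture-grade BY CONTENT, and 19226 as stated cannot close from print (director row «if
   found ⇒ 19226 closes»: NOT found). §5 = the same reduction through inert g10's three-binder
   theorem (p410220) with `hKO` discharged. Planner recommendation (cell STATUS 2026-08-26): split
   19226 into its conjecture-grade conjunct 1 and the readings conjunct 2 (closable by §4's pattern).

References: [Kobayashi2003] Thm. 2.2 (p. 5), §4 + Thm. 4.1 (p. 8), Thm. 7.4 (p. 13);
[KitajimaOtsuki2018] Main Thm. 1.3 with Def. 2.1; [PollackRubin2004] p. 448; [Lei2011] §1, §7.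
-/

set_option autoImplicit false
-- `Summit.BirchSwinnertonDyer.BirchSwinnertonDyer.…` is the lane's mandated namespace (sub = summit).
set_option linter.dupNamespace false

noncomputable section

open scoped Classical

open CongruenceSubgroup WeierstrassCurve Field Literature.NumberTheory.EllipticCurves
  Literature.NumberTheory.EllipticCurves.ModularForms
  Literature.NumberTheory.EllipticCurves.Rank1Residual
  Literature.NumberTheory.GaloisRepresentations ZpExtension
  Summit.BirchSwinnertonDyer.Rank1Residual Summit.BirchSwinnertonDyer.Rank1Residual.Additive

namespace Summit.BirchSwinnertonDyer.BirchSwinnertonDyer.Theorems.PrintReadingsOfLiterature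

/-! ## §1 The bridge: Literature copy = Summits original (`rfl`) -/

section Bridge

universe u

variable {K : Type u} [Field K] [NumberField K] {p : ℕ} [Fact p.Prime]
  (W : WeierstrassCurve K) (κ : ZpExtension K p) (K₀ : Type u) [Field K₀] [NumberField K₀]
  [Algebra K K₀] [(galRange (K := K) K₀).Normal] (E : Type u) [Field E] [Algebra K E]
  (η : absoluteGaloisGroup K →* ℤˣ) (γ : absoluteGaloisGroup K) (ε : ℤˣ)

/-- **The transport**: a Summits-side dual datum of `Sel^ε(E/K_∞)^η` IS a Literature-side one, with
the same module (all fields carried along the `rfl` above).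
[cite: Kobayashi2003, Def. 2.1 (p. 5), §4 p. 8] -/
def toLiterature (D : Additive.EtaSignedSelmerDualData W κ K₀ E η γ ε) :
    Literature.NumberTheory.EllipticCurves.Kobayashi2003.EtaSignedSelmerDualData W κ K₀ E η γ ε :=
  ⟨D.X, D.conj_mem, D.toDual, D.bijective, D.toDual_T_smul, D.toDual_C_smul⟩

/-- Same module and same characteristic ideal. [cite: Kobayashi2003, §4 p. 8] -/
theorem toLiterature_charIdeal (D : Additive.EtaSignedSelmerDualData W κ K₀ E η γ ε) :
    (toLiterature W κ K₀ E η γ ε D).X = D.X ∧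
      (toLiterature W κ K₀ E η γ ε D).charIdeal = D.charIdeal := ⟨rfl, rfl⟩

/-- **The transport back**: a Literature-side datum IS a Summits-side one (same fields).
[cite: Kobayashi2003, Def. 2.1 (p. 5), §4 p. 8] -/
def ofLiterature
    (D' : Literature.NumberTheory.EllipticCurves.Kobayashi2003.EtaSignedSelmerDualData W κ K₀ E η γ ε) :
    Additive.EtaSignedSelmerDualData W κ K₀ E η γ ε :=
  ⟨D'.X, D'.conj_mem, D'.toDual, D'.bijective, D'.toDual_T_smul, D'.toDual_C_smul⟩

/-- Same module and same characteristic ideal. [cite: Kobayashi2003, §4 p. 8] -/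
theorem ofLiterature_charIdeal
    (D' : Literature.NumberTheory.EllipticCurves.Kobayashi2003.EtaSignedSelmerDualData W κ K₀ E η γ ε) :
    (ofLiterature W κ K₀ E η γ ε D').X = D'.X ∧
      (ofLiterature W κ K₀ E η γ ε D').charIdeal = D'.charIdeal := ⟨rfl, rfl⟩

end Bridge

section Predicates

variable {N : ℕ} (f : CuspForm (Gamma0 N) 2) (p : ℕ) [Fact p.Prime] (ϖ : ℚ) (L : IwasawaAlgebra p)

/-- The Literature copy of the PLUS pinning predicate is the Summits original.
[cite: Kobayashi2003, (3.4) and (3.6) (p. 7)] -/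
theorem isQuadraticBranchPlusLFunction_iff_additive :
    Literature.NumberTheory.EllipticCurves.Kobayashi2003.IsQuadraticBranchPlusLFunction f p ϖ L ↔
      Additive.IsQuadraticBranchPlusLFunction f p ϖ L := Iff.rfl

/-- The Literature copy of the MINUS pinning predicate is the Summits original.
[cite: Kobayashi2003, (3.5) and (3.7) (p. 7)] -/
theorem isQuadraticBranchMinusLFunction_iff_additive :
    Literature.NumberTheory.EllipticCurves.Kobayashi2003.IsQuadraticBranchMinusLFunction f p ϖ L ↔
      Additive.IsQuadraticBranchMinusLFunction f p ϖ L := Iff.rfl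

end Predicates

/-! ## §2 The verbatim hypothesis TEXTS of the kernel dictionary theorems, from the named facts -/

section Texts

variable (p : ℕ) [Fact p.Prime]

/-- **Text `h22` (Kobayashi Thm. 2.2 at `η`, both signs) from the named fact.**
[cite: Kobayashi2003, Thm. 2.2 (p. 5) and §4 p. 8 l. 16] -/
theorem kobayashi22Text_of_fact
    (h : Literature.NumberTheory.EllipticCurves.Kobayashi2003.thm22_etaSignedSelmerDual_finite_torsion) :
    ∀ (K₀ : Type) [Field K₀] [NumberField K₀] [IsCyclotomicExtension {p} ℚ K₀]
      [(galRange (K := ℚ) K₀).Normal] (η : absoluteGaloisGroup ℚ →* ℤˣ),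
      (∀ σ ∈ galRange (K := ℚ) K₀, η σ = 1) →
    ∀ (V : WeierstrassCurve ℚ) [V.IsElliptic] [V.IsGloballyMinimal],
      p ≠ 2 → V.HasGoodReductionAtPrime p → V.frobeniusTrace p = 0 →
    ∀ (κ : ZpExtension ℚ p) (γ : absoluteGaloisGroup ℚ),
      κ.IsCyclotomic → κ.IsTopGenerator γ → γ ∈ galRange (K := ℚ) K₀ →
    ∀ (ε : ℤˣ) (D : EtaSignedSelmerDualData V κ K₀ ℚ_[p] η γ ε),
      Module.Finite (IwasawaAlgebra p) D.X ∧ Module.IsTorsion (IwasawaAlgebra p) D.X :=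
  fun K₀ _ _ _ _ η hηK V _ _ hp hgood hap κ γ hκ hγ hγK ε D ↦
    h p K₀ η hηK V hp hgood hap κ γ hκ hγ hγK ε (toLiterature V κ K₀ ℚ_[p] η γ ε D)

/-- **Text `h41` (Kobayashi Thm. 4.1 third display at `η ≠ 1`) from the named fact.**
[cite: Kobayashi2003, Thm. 4.1 (p. 8)] -/
theorem kobayashi41Text_of_fact
    (h : Literature.NumberTheory.EllipticCurves.Kobayashi2003.thm41_minusEtaCharIdeal_dvd) :
    ∀ (K₀ : Type) [Field K₀] [NumberField K₀] [IsCyclotomicExtension {p} ℚ K₀]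
      [(galRange (K := ℚ) K₀).Normal] (η : absoluteGaloisGroup ℚ →* ℤˣ),
      (∀ σ ∈ galRange (K := ℚ) K₀, η σ = 1) → η ≠ 1 →
    ∀ (V : WeierstrassCurve ℚ) [V.IsElliptic] [V.IsGloballyMinimal] {N : ℕ} [NeZero N]
      {f : CuspForm (Gamma0 N) 2},
      p ≠ 2 → V.HasGoodReductionAtPrime p → V.frobeniusTrace p = 0 → IsNewformOf V f →
    ∀ (ϖ : ℚ), (if Even (p / 2) then (ϖ : ℝ) * V.realPeriodRat = plusPeriod f
        else (ϖ : ℝ) * V.imaginaryPeriodRat = minusPeriod f) →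
    ∀ (Lη : IwasawaAlgebra p), IsQuadraticBranchMinusLFunction f p ϖ Lη →
    ∀ (κ : ZpExtension ℚ p) (γ : absoluteGaloisGroup ℚ),
      κ.IsCyclotomic → κ.IsTopGenerator γ → γ ∈ galRange (K := ℚ) K₀ →
      IsCyclotomicVariable p γ →
    ∀ (D : EtaSignedSelmerDualData V κ K₀ ℚ_[p] η γ (-1)),
      Module.Finite (IwasawaAlgebra p) D.X → Module.IsTorsion (IwasawaAlgebra p) D.X →
      (∃ n : ℕ, ∀ L' : IwasawaAlgebra p, Lη = PowerSeries.X * L' →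
          (p : IwasawaAlgebra p) ^ n * L' ∈ D.charIdeal) ∧
      ((∀ m : ℕ, V.HasSurjectiveModNGaloisRep (p ^ m : ℕ)) →
          ∀ L' : IwasawaAlgebra p, Lη = PowerSeries.X * L' → L' ∈ D.charIdeal) :=
  fun K₀ _ _ _ _ η hηK hη1 V _ _ _ _ _ hp hgood hap hf ϖ hϖ Lη hL κ γ hκ hγ hγK hγc D ↦
    h p K₀ η hηK hη1 V hp hgood hap hf ϖ hϖ Lη hL κ γ hκ hγ hγK hγc
      (toLiterature V κ K₀ ℚ_[p] η γ (-1) D)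

/-- **Text `hKO` (Kitajima–Otsuki Main Thm. 1.3, sign `−`, `η`-part) from the named fact.**
[cite: KitajimaOtsuki2018, Main Thm. 1.3 (= Thm. 4.8) with Def. 2.1] -/
theorem kitajimaOtsukiMinusText_of_fact
    (h : Literature.NumberTheory.EllipticCurves.KitajimaOtsuki2018.mainThm13_etaSignedSelmerDual_noFiniteSubmodule) :
    ∀ (K₀ : Type) [Field K₀] [NumberField K₀] [IsCyclotomicExtension {p} ℚ K₀]
      [(galRange (K := ℚ) K₀).Normal] (η : absoluteGaloisGroup ℚ →* ℤˣ),
      (∀ σ ∈ galRange (K := ℚ) K₀, η σ = 1) →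
    ∀ (V : WeierstrassCurve ℚ) [V.IsElliptic] [V.IsGloballyMinimal],
      p ≠ 2 → V.HasGoodReductionAtPrime p → V.frobeniusTrace p = 0 →
    ∀ (κ : ZpExtension ℚ p) (γ : absoluteGaloisGroup ℚ),
      κ.IsCyclotomic → κ.IsTopGenerator γ → γ ∈ galRange (K := ℚ) K₀ →
    ∀ (D : EtaSignedSelmerDualData V κ K₀ ℚ_[p] η γ (-1)),
      Module.Finite (IwasawaAlgebra p) D.X → Module.IsTorsion (IwasawaAlgebra p) D.X →
      ∀ M : Submodule (IwasawaAlgebra p) D.X, Finite M → M = ⊥ :=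
  fun K₀ _ _ _ _ η hηK V _ _ hp hgood hap κ γ hκ hγ hγK D ↦
    h p K₀ η hηK V hp hgood hap κ γ hκ hγ hγK (-1) (toLiterature V κ K₀ ℚ_[p] η γ (-1) D)

/-- **Text `hKO⁺` (Kitajima–Otsuki Main Thm. 1.3, sign `+`, `η`-part) from the named fact** — the
hypothesis of cell bsd-potss's `SignedTwist.evenBranchPlusNoFiniteSubmoduleAt_of_kitajimaOtsuki13PlusEta`.
[cite: KitajimaOtsuki2018, Main Thm. 1.3 (= Thm. 4.8) with Def. 2.1] -/
theorem kitajimaOtsukiPlusText_of_fact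
    (h : Literature.NumberTheory.EllipticCurves.KitajimaOtsuki2018.mainThm13_etaSignedSelmerDual_noFiniteSubmodule) :
    ∀ (K₀ : Type) [Field K₀] [NumberField K₀] [IsCyclotomicExtension {p} ℚ K₀]
      [(galRange (K := ℚ) K₀).Normal] (η : absoluteGaloisGroup ℚ →* ℤˣ),
      (∀ σ ∈ galRange (K := ℚ) K₀, η σ = 1) →
    ∀ (V : WeierstrassCurve ℚ) [V.IsElliptic] [V.IsGloballyMinimal],
      p ≠ 2 → V.HasGoodReductionAtPrime p → V.frobeniusTrace p = 0 →
    ∀ (κ : ZpExtension ℚ p) (γ : absoluteGaloisGroup ℚ),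
      κ.IsCyclotomic → κ.IsTopGenerator γ → γ ∈ galRange (K := ℚ) K₀ →
    ∀ (D : EtaSignedSelmerDualData V κ K₀ ℚ_[p] η γ 1),
      Module.Finite (IwasawaAlgebra p) D.X → Module.IsTorsion (IwasawaAlgebra p) D.X →
      ∀ M : Submodule (IwasawaAlgebra p) D.X, Finite M → M = ⊥ :=
  fun K₀ _ _ _ _ η hηK V _ _ hp hgood hap κ γ hκ hγ hγK D ↦
    h p K₀ η hηK V hp hgood hap κ γ hκ hγ hγK 1 (toLiterature V κ K₀ ℚ_[p] η γ 1 D)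

/-- **The `K_∞`-form of Kobayashi Thm. 7.4 at `η` on the Summits object, from the named fact**
(even MC at `η` on `X⁺(V/K_∞)^η` ⟺ odd MC at `η` on `X⁻(V/K_∞)^η`).
[cite: Kobayashi2003, Thm. 7.4 (p. 13), §4 (p. 8)] -/
theorem kobayashi74Text_of_fact
    (h : Literature.NumberTheory.EllipticCurves.Kobayashi2003.thm74_etaEvenMC_iff_etaOddMC) :
    ∀ (K₀ : Type) [Field K₀] [NumberField K₀] [IsCyclotomicExtension {p} ℚ K₀]
      [(galRange (K := ℚ) K₀).Normal] (η : absoluteGaloisGroup ℚ →* ℤˣ),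
      (∀ σ ∈ galRange (K := ℚ) K₀, η σ = 1) → η ≠ 1 →
    ∀ (V : WeierstrassCurve ℚ) [V.IsElliptic] [V.IsGloballyMinimal] {N : ℕ} [NeZero N]
      {f : CuspForm (Gamma0 N) 2},
      p ≠ 2 → V.HasGoodReductionAtPrime p → V.frobeniusTrace p = 0 → IsNewformOf V f →
    ∀ (ϖ : ℚ), (if Even (p / 2) then (ϖ : ℝ) * V.realPeriodRat = plusPeriod f
        else (ϖ : ℝ) * V.imaginaryPeriodRat = minusPeriod f) →
    ∀ (κ : ZpExtension ℚ p) (γ : absoluteGaloisGroup ℚ),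
      κ.IsCyclotomic → κ.IsTopGenerator γ → γ ∈ galRange (K := ℚ) K₀ →
      IsCyclotomicVariable p γ →
    ((∀ (Lp : IwasawaAlgebra p), IsQuadraticBranchPlusLFunction f p ϖ Lp →
        ∀ D : EtaSignedSelmerDualData V κ K₀ ℚ_[p] η γ 1, D.charIdeal = Ideal.span {Lp}) ↔
      (∀ (Lm : IwasawaAlgebra p), IsQuadraticBranchMinusLFunction f p ϖ Lm →
        ∀ (D : EtaSignedSelmerDualData V κ K₀ ℚ_[p] η γ (-1)) (L' : IwasawaAlgebra p),
          Lm = PowerSeries.X * L' → D.charIdeal = Ideal.span {L'})) := by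
  intro K₀ _ _ _ _ η hηK hη1 V _ _ N _ f hp hgood hap hf ϖ hϖ κ γ hκ hγ hγK hγc
  have hiff := h p K₀ η hηK hη1 V hp hgood hap hf ϖ hϖ κ γ hκ hγ hγK hγc
  constructor
  · intro hEven Lm hLm D L' hLL'
    refine hiff.mp (fun Lp hLp D' ↦ ?_) Lm hLm (toLiterature V κ K₀ ℚ_[p] η γ (-1) D) L' hLL'
    exact hEven Lp hLp (ofLiterature V κ K₀ ℚ_[p] η γ 1 D')
  · intro hOdd Lp hLp D
    refine hiff.mpr (fun Lm hLm D' L' hLL' ↦ ?_) Lp hLp (toLiterature V κ K₀ ℚ_[p] η γ 1 D)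
    exact hOdd Lm hLm (ofLiterature V κ K₀ ℚ_[p] η γ (-1) D') L' hLL'

end Texts

/-! ## §3 (R1) and (R2) for EVERY `(W, p)`, modulo the named published facts -/

section Readings

variable (W : WeierstrassCurve ℚ) [W.IsElliptic] [W.IsGloballyMinimal] (p : ℕ) [Fact p.Prime]

/-- **(R2) `OddBranchStrictMinusNoFiniteSubmoduleAt W p` for every `(W, p)`, modulo the named fact
Kitajima–Otsuki 2018 Main Thm. 1.3** (via x1b's P5-5b dictionary theorem): the registered typed
input of `Additive/QuadraticBranchOddStrictSelmerReadings.lean` is a THEOREM conditional on one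
published fact. [cite: KitajimaOtsuki2018, Main Thm. 1.3 (= Thm. 4.8) with Def. 2.1]
[cite: Kobayashi2003, §4 p. 8] -/
theorem oddBranchStrictMinusNoFiniteSubmoduleAt_of_kitajimaOtsuki
    (hKO : Literature.NumberTheory.EllipticCurves.KitajimaOtsuki2018.mainThm13_etaSignedSelmerDual_noFiniteSubmodule) :
    OddBranchStrictMinusNoFiniteSubmoduleAt W p :=
  SignedTwist.oddBranchStrictMinusNoFiniteSubmoduleAt_of_kitajimaOtsuki13MinusEta W p
    (kitajimaOtsukiMinusText_of_fact p hKO)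

/-- **(R1) `OddBranchStrictMinusDivisibilityAt W p` for every `(W, p)`, modulo the named facts
Kobayashi 2003 Thm. 2.2 (at `η`) and Thm. 4.1 (third display)** (via x1b's P5-5b dictionary
theorem). [cite: Kobayashi2003, Thm. 2.2 (p. 5), Thm. 4.1 (p. 8)] -/
theorem oddBranchStrictMinusDivisibilityAt_of_kobayashi
    (h22 : Literature.NumberTheory.EllipticCurves.Kobayashi2003.thm22_etaSignedSelmerDual_finite_torsion)
    (h41 : Literature.NumberTheory.EllipticCurves.Kobayashi2003.thm41_minusEtaCharIdeal_dvd) :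
    OddBranchStrictMinusDivisibilityAt W p :=
  SignedTwist.oddBranchStrictMinusDivisibilityAt_of_kobayashi41OddEta W p
    (kobayashi22Text_of_fact p h22) (kobayashi41Text_of_fact p h41)

end Readings

/-! ## §4 The item `PrintReadingsInert` reduced to (C1_η)-for-CM (two verbatim forms) + named facts -/

section Item

/-- `j` is unchanged along `C • W^{(d)} = V` (Mathlib `variableChange_j`, tree `j_quadraticTwist`).
[folklore] -/
theorem j_eq_of_smul_quadraticTwist_eq {W V : WeierstrassCurve ℚ} [W.IsElliptic] [V.IsElliptic]
    {C : VariableChange ℚ} {d : ℚ} (hd : d ≠ 0) (h : C • W.quadraticTwist d = V) : V.j = W.j := by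
  subst h
  haveI := W.isElliptic_quadraticTwist hd
  rw [WeierstrassCurve.variableChange_j, W.j_quadraticTwist hd]

/-- A model of a quadratic twist of a CM curve is CM (same `j`; tree `hasCM_iff_of_j_eq`).
[cite: SilvermanAEC2009, App. C §11 (C.11.3.1) with X.5.4] -/
theorem hasCM_of_smul_quadraticTwist_eq {W V : WeierstrassCurve ℚ} [W.IsElliptic] [V.IsElliptic]
    {C : VariableChange ℚ} {d : ℚ} (hd : d ≠ 0) (h : C • W.quadraticTwist d = V) (hW : W.HasCM) :
    V.HasCM :=
  (hasCM_iff_of_j_eq (j_eq_of_smul_quadraticTwist_eq hd h)).2 hW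

/-- `p* = (−1)^{⌊p/2⌋}·p ≠ 0`. [folklore] -/
theorem pStar_ne_zero (p : ℕ) [Fact p.Prime] : ((-1 : ℚ) ^ (p / 2) * p) ≠ 0 :=
  mul_ne_zero (pow_ne_zero _ (by norm_num)) (Nat.cast_ne_zero.mpr (Fact.out : p.Prime).ne_zero)

/-- **`PrintReadingsInert` ⟸ two named PUBLISHED facts ∧ (C1_η)-for-CM in its two verbatim forms.**
Binders: `hKO` = Kitajima–Otsuki 2018 Main Thm. 1.3 (named fact); `h74` = Kobayashi 2003 Thm. 7.4
at `η` (named fact); `hC1` = CONJUNCT 1 OF THE ITEM ITSELF — Kobayashi's even main conjecture at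
`η` for CM good-inert `V`, `p ≥ 5`, in the `ℚ(√p*)`-subtower form
`Additive.QuadraticBranchPlusMainConjectureAt V p`; `hC1K` = the same conjecture for CM `V` in
Kobayashi's own `K_∞`-form, VERBATIM §4 p. 8 "`Char(X⁺(E/K_∞)^η) = (L_p⁺(E, η, X))`" on the
`η`-component object. For CM `V` both are Pollack–Rubin's p. 448 REMARK ("With the same proof …
for `Sel^±_p(E/ℚ(μ_{p^∞}))`"), NOT a printed theorem (Lei 2011 §7: `θ = 1` only; Kato 2004 §15
p. 251: divisibility only) — conjecture-grade by content, carried, not discharged. Proof: conjunct 1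
is `hC1`; conjunct 2 = (R2) from `hKO` (§3) and, for the exact odd reading at the twin `V` of `W`
(CM, since `W` is: same `j`), Thm. 7.4 at `η` turns `hC1K` into the odd main conjecture at `η` on
`X⁻(V/K_∞)^η`, which x1b's dictionary (`StrictSignedSelmerDualData.toEtaSigned`, `K₀ = ℚ(μ_p)`,
`θ² = p*`, `γ ↦ γ' ∈ Gal(ℚ̄/K₀)`) reads on the strict-minus datum of `W`. CONDITIONAL on the two
conjecture-grade binders; nothing booked; closes nothing by itself.
[cite: Kobayashi2003, §4 (p. 8), Thm. 7.4 (p. 13)] [cite: KitajimaOtsuki2018, Main Thm. 1.3]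
[cite: PollackRubin2004, Theorem and the remark on Sel over ℚ(μ_{p^∞}) (p. 448)]
[cite: Lei2011, §7 (Thm. 7.9, Cor. 7.10: the case θ = 1)] -/
theorem printReadingsInert_of_plusMCEtaCM
    (hKO : Literature.NumberTheory.EllipticCurves.KitajimaOtsuki2018.mainThm13_etaSignedSelmerDual_noFiniteSubmodule)
    (h74 : Literature.NumberTheory.EllipticCurves.Kobayashi2003.thm74_etaEvenMC_iff_etaOddMC)
    (hC1 : ∀ (p : ℕ) [Fact p.Prime], 5 ≤ p →
      ∀ (V : WeierstrassCurve ℚ) [V.IsElliptic] [V.IsGloballyMinimal], V.HasCM →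
        V.HasGoodReductionAtPrime p → CMInert V p → QuadraticBranchPlusMainConjectureAt V p)
    (hC1K : ∀ (p : ℕ) [Fact p.Prime], 5 ≤ p →
      ∀ (K₀ : Type) [Field K₀] [NumberField K₀] [IsCyclotomicExtension {p} ℚ K₀]
        [(galRange (K := ℚ) K₀).Normal] (η : absoluteGaloisGroup ℚ →* ℤˣ),
        (∀ σ ∈ galRange (K := ℚ) K₀, η σ = 1) → η ≠ 1 →
      ∀ (V : WeierstrassCurve ℚ) [V.IsElliptic] [V.IsGloballyMinimal] {N : ℕ} [NeZero N]
        {f : CuspForm (Gamma0 N) 2}, V.HasCM →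
        p ≠ 2 → V.HasGoodReductionAtPrime p → V.frobeniusTrace p = 0 → IsNewformOf V f →
      ∀ (ϖ : ℚ), (if Even (p / 2) then (ϖ : ℝ) * V.realPeriodRat = plusPeriod f
          else (ϖ : ℝ) * V.imaginaryPeriodRat = minusPeriod f) →
      ∀ (κ : ZpExtension ℚ p) (γ : absoluteGaloisGroup ℚ),
        κ.IsCyclotomic → κ.IsTopGenerator γ → γ ∈ galRange (K := ℚ) K₀ → IsCyclotomicVariable p γ →
      ∀ (Lp : IwasawaAlgebra p), IsQuadraticBranchPlusLFunction f p ϖ Lp →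
      ∀ D : EtaSignedSelmerDualData V κ K₀ ℚ_[p] η γ 1, D.charIdeal = Ideal.span {Lp}) :
    Summit.BirchSwinnertonDyer.BirchSwinnertonDyer.Theses.InertBadSignedBranches.PrintReadingsInert := by
  unfold Summit.BirchSwinnertonDyer.BirchSwinnertonDyer.Theses.InertBadSignedBranches.PrintReadingsInert
  intro p _ hp5
  refine ⟨fun V _ _ hCM hgood hin ↦ hC1 p hp5 V hCM hgood hin, fun W _ _ hT _hr ↦ ⟨?_, ?_⟩⟩
  · exact oddBranchStrictMinusNoFiniteSubmoduleAt_of_kitajimaOtsuki W p hKO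
  · intro V _ _ C N _ f hp2 hCV hgood hap _h1 hf ϖ hϖ Lη hL κ γ hκ hγ hγc D L' hLL'
    haveI : NeZero p := ⟨(Fact.out : p.Prime).ne_zero⟩
    haveI : IsCyclotomicExtension {p} ℚ (CyclotomicField p ℚ) :=
      CyclotomicField.isCyclotomicExtension p ℚ
    haveI : (galRange (K := ℚ) (CyclotomicField p ℚ)).Normal := normal_galRange_cyclotomic p _
    obtain ⟨θ, ηθ, hθ, hc, hη, hηK, hη1⟩ := SignedTwist.exists_theta_eta_cyclotomicField p hp2
    have hD := SignedTwist.localTowerHyp_padic p κ (CyclotomicField p ℚ) hκ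
    have hκ₀ := kappa_surjOn_galRange_cyclotomic κ (CyclotomicField p ℚ)
    have hcop := coprime_index_galRange_cyclotomic p (CyclotomicField p ℚ)
    obtain ⟨γ', hγ'K, hγ'κ⟩ := hκ₀ (κ γ)
    have hγγ' : γ⁻¹ * γ' ∈ κ.kerSubgroup := by
      rw [ZpExtension.mem_kerSubgroup, map_mul, map_inv, hγ'κ, inv_mul_cancel]
    have hγ' : κ.IsTopGenerator γ' := by rw [ZpExtension.IsTopGenerator, hγ'κ]; exact hγ
    have hγ'c : IsCyclotomicVariable p γ' :=
      SignedTwist.isCyclotomicVariable_of_inv_mul_mem_ker hκ hγγ' hγc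
    have hCMV : V.HasCM := hasCM_of_smul_quadraticTwist_eq (pStar_ne_zero p) hCV hT.1
    have hEven := hC1K p hp5 (CyclotomicField p ℚ) ηθ hηK hη1 V hCMV hp2 hgood hap hf ϖ hϖ κ γ'
      hκ hγ' hγ'K hγ'c
    have hOdd := (kobayashi74Text_of_fact p h74 (CyclotomicField p ℚ) ηθ hηK hη1 V hp2 hgood hap hf
      ϖ hϖ κ γ' hκ hγ' hγ'K hγ'c).mp hEven
    have h := hOdd Lη hL
      (D.toEtaSigned W (CyclotomicField p ℚ) hθ hc p κ hCV ηθ hη ℚ_[p] hD hκ₀ hcop hγ'K hγγ') L' hLL'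
    rwa [StrictSignedSelmerDualData.toEtaSigned_charIdeal] at h

/-! ## §5 Inert g10's three-binder reduction (p410220) with `hKO` discharged by the named fact -/

/-- **`PrintReadingsInert` ⟸ (C1_η)-CM (`hC1`, conjunct 1) ∧ the exact reading text `h74X`**, the
binder `hKO` of `inertBadSignedBranches_printReadingsInert_of_plusMC_of_verbatimReadings` being
supplied by Kitajima–Otsuki's named fact. (`h74X` keeps its `QuadraticBranchPlusMainConjectureAt`
hypothesis in the `ℚ(√p*)`-form; §4 is the version on Kobayashi's own object.) CONDITIONAL.
[cite: KitajimaOtsuki2018, Main Thm. 1.3] [cite: Kobayashi2003, Thm. 7.4 (p. 13)] -/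
theorem printReadingsInert_of_plusMC_of_h74X
    (hKO : Literature.NumberTheory.EllipticCurves.KitajimaOtsuki2018.mainThm13_etaSignedSelmerDual_noFiniteSubmodule)
    (hC1 : ∀ (p : ℕ) [Fact p.Prime], 5 ≤ p →
      ∀ (V : WeierstrassCurve ℚ) [V.IsElliptic] [V.IsGloballyMinimal], V.HasCM →
        V.HasGoodReductionAtPrime p → CMInert V p → QuadraticBranchPlusMainConjectureAt V p)
    (h74X : ∀ (p : ℕ) [Fact p.Prime], 5 ≤ p →
      ∀ (K₀ : Type) [Field K₀] [NumberField K₀] [IsCyclotomicExtension {p} ℚ K₀]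
        [(galRange (K := ℚ) K₀).Normal] (ηq : absoluteGaloisGroup ℚ →* ℤˣ),
        (∀ σ ∈ galRange (K := ℚ) K₀, ηq σ = 1) → ηq ≠ 1 →
      ∀ (V : WeierstrassCurve ℚ) [V.IsElliptic] [V.IsGloballyMinimal] {N : ℕ} [NeZero N]
        {f : CuspForm (Gamma0 N) 2},
        p ≠ 2 → V.HasGoodReductionAtPrime p → V.frobeniusTrace p = 0 →
        QuadraticBranchPlusMainConjectureAt V p → IsNewformOf V f →
      ∀ (ϖ : ℚ), (if Even (p / 2) then (ϖ : ℝ) * V.realPeriodRat = plusPeriod f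
          else (ϖ : ℝ) * V.imaginaryPeriodRat = minusPeriod f) →
      ∀ (Lη : IwasawaAlgebra p), IsQuadraticBranchMinusLFunction f p ϖ Lη →
      ∀ (κ : ZpExtension ℚ p) (γ : absoluteGaloisGroup ℚ),
        κ.IsCyclotomic → κ.IsTopGenerator γ → γ ∈ galRange (K := ℚ) K₀ →
        IsCyclotomicVariable p γ →
      ∀ (D : EtaSignedSelmerDualData V κ K₀ ℚ_[p] ηq γ (-1)) (L' : IwasawaAlgebra p),
        Lη = PowerSeries.X * L' → D.charIdeal = Ideal.span {L'}) :
    Summit.BirchSwinnertonDyer.BirchSwinnertonDyer.Theses.InertBadSignedBranches.PrintReadingsInert :=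
  inertBadSignedBranches_printReadingsInert_of_plusMC_of_verbatimReadings hC1
    (fun p _ _ ↦ kitajimaOtsukiMinusText_of_fact p hKO) h74X

end Item

end Summit.BirchSwinnertonDyer.BirchSwinnertonDyer.Theorems.PrintReadingsOfLiterature
end
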